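import Literature.NumberTheory.QuadraticForms.HilbertSymbolUnramified
import Mathlib.FieldTheory.Finite.Basic
import HarnessLib

/-!
# The dyadic Hilbert symbol against `5`: `(t, 5)_v = −1` iff `f(v|2)` and `ord_v t` are both odd

Topic `NumberTheory/QuadraticForms`; namespace `Literature.NumberTheory.QuadraticForms` (sequel of
`HilbertSymbolUnramified.lean`, O'Meara §63A / Example 63:16 at `θ = 1 + 4ρ` with `ρ = 1`).  THEOREMS only (no definition,
no named fact, no `sorry`).

For a finite place `v ∣ 2` of a number field `K` with `N v = 2^f`: the quadratic extension `K_v(√5)/K_v` is unramified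
(`5 = 1 + 4·1`), and it is split iff `X² − X − 1 ≡ X² + X + 1` has a root in the residue field `𝔽_{2^f}`, i.e. iff `𝔽_{2^f}`
contains a primitive cube root of unity, i.e. iff `f` is even.  Hence (O'Meara 63:16) `(t, 5)_v = −1` iff `f` is odd and
`ord_v t` is odd.  This is the `𝔭`-adic input of the dyadic case of [Liu2021, Thm. 4.18 (3)] (cell hodgecm-mathlib, row
III-11c; `Liu2021/Thm418CyclotomicUnitsLocalNormsDyadic`): against the projection formula it reads off the parity of the
`2`-exponent of `N_{K_v/ℚ₂} θ`.  HC_CM is proved only modulo the printed citations until rung 0 closes.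

* `FiniteField.exists_sq_add_self_add_one_eq_zero_iff_even` — `x² + x + 1` has a root in a finite field of characteristic `2`
  and cardinality `2^f` iff `f` is even;
* `isSquare_five_adicCompletion_iff_even` — `5 ∈ (K_v)²` iff `f` is even (`v ∣ 2`);
* `hilbertSymbol_five_eq_neg_one_iff` — `(t, 5)_v = −1 ↔ f odd ∧ ord_v t odd` (`v ∣ 2`, `t ≠ 0`).

## References
* [Omeara1963] O. T. O'Meara, *Introduction to Quadratic Forms* (1963), §63A (quadratic defect of `1 + 4ρ`), §63C Example 63:16.
* [Serre1973] J.-P. Serre, *A Course in Arithmetic* (1973), Ch. I §1.1 Thm 2 (the multiplicative group of a finite field is cyclic).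
-/

set_option autoImplicit false

noncomputable section

open scoped NumberField Valued
open NumberField IsDedekindDomain IsDedekindDomain.HeightOneSpectrum

namespace Literature.NumberTheory.QuadraticForms

section Local

variable {K : Type} [Field K] [NumberField K] (v : HeightOneSpectrum (𝓞 K))

/-- **`x² + x + 1` has a root in a finite field of characteristic `2` and cardinality `2^f` iff `f` is even** (a root is a
primitive cube root of unity: `3 ∣ 2^f − 1` iff `f` even; `𝔽_q^×` is cyclic). [cite: Serre1973, Ch. I §1.1 Thm 2] -/
theorem FiniteField.exists_sq_add_self_add_one_eq_zero_iff_even {k : Type*} [Field k] [Fintype k] [CharP k 2] {f : ℕ}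
    (hk : Fintype.card k = 2 ^ f) : (∃ x : k, x ^ 2 + x + 1 = 0) ↔ Even f := by
  have h2 : (2 : k) = 0 := by
    have := CharP.cast_eq_zero k 2
    simpa using this
  constructor
  · rintro ⟨x, hx⟩
    by_contra hodd
    rw [Nat.not_even_iff_odd] at hodd
    obtain ⟨g, rfl⟩ := hodd
    have hx3 : x ^ 3 = 1 := by linear_combination (x - 1) * hx
    -- `4^g = 3 t + 1`, so `x = x^{2^{2g+1}} = x^{6t+2} = x²`
    obtain ⟨t, ht⟩ : 3 ∣ 4 ^ g - 1 := by simpa using Nat.sub_one_dvd_pow_sub_one 4 g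
    have h4 : 4 ^ g = 3 * t + 1 := by
      have := Nat.one_le_pow g 4 (by norm_num)
      omega
    have hfrob := FiniteField.pow_card x
    rw [hk, pow_succ, show (2 : ℕ) ^ (2 * g) = 4 ^ g by rw [pow_mul]; norm_num, h4,
      show (3 * t + 1) * 2 = 3 * (2 * t) + 2 by ring, pow_add, pow_mul, hx3, one_pow, one_mul] at hfrob
    -- `x² = x` forces `x ∈ {0, 1}`, neither of which is a root
    have hx01 : x = 0 ∨ x = 1 := by
      have : x * (x - 1) = 0 := by linear_combination hfrob
      rcases mul_eq_zero.mp this with h | h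
      · exact Or.inl h
      · exact Or.inr (sub_eq_zero.mp h)
    rcases hx01 with rfl | rfl
    · norm_num at hx
    · have : (1 : k) = 0 := by linear_combination hx - h2
      exact one_ne_zero this
  · rintro ⟨g, rfl⟩
    classical
    -- a generator `ζ` of `kˣ` (order `2^{2g} − 1 = 3t`); `x = ζ^t` is a primitive cube root of unity
    obtain ⟨ζ, hζ⟩ := IsCyclic.exists_generator (α := kˣ)
    have hord : orderOf ζ = 2 ^ (g + g) - 1 := by
      rw [orderOf_eq_card_of_forall_mem_zpowers hζ, Nat.card_eq_fintype_card, Fintype.card_units, hk]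
    obtain ⟨t, ht⟩ : 3 ∣ 2 ^ (g + g) - 1 := by
      rw [← two_mul, pow_mul, show (2 : ℕ) ^ 2 = 4 by norm_num]
      simpa using Nat.sub_one_dvd_pow_sub_one 4 g
    have hcard1 : 1 < Fintype.card k := Fintype.one_lt_card
    rw [hk] at hcard1
    have ht0 : t ≠ 0 := by
      rintro rfl
      omega
    have hx1 : ζ ^ t ≠ 1 := pow_ne_one_of_lt_orderOf ht0 (by rw [hord]; omega)
    have hx3 : (ζ ^ t) ^ 3 = 1 := by
      rw [← pow_mul, mul_comm, ← ht, ← hord]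
      exact pow_orderOf_eq_one ζ
    refine ⟨((ζ ^ t : kˣ) : k), ?_⟩
    have hy3 : ((ζ ^ t : kˣ) : k) ^ 3 = 1 := by
      rw [← Units.val_pow_eq_pow_val, hx3, Units.val_one]
    have hy1 : ((ζ ^ t : kˣ) : k) ≠ 1 := fun h ↦ hx1 (Units.ext (by simpa using h))
    have hfac : (((ζ ^ t : kˣ) : k) - 1) * (((ζ ^ t : kˣ) : k) ^ 2 + ((ζ ^ t : kˣ) : k) + 1) = 0 := by
      linear_combination hy3
    rcases mul_eq_zero.mp hfac with h | h
    · exact absurd (sub_eq_zero.mp h) hy1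
    · exact h

/-- **`5 = 1 + 4·1` is a square in `K_v` (`v ∣ 2`, `N v = 2^f`) iff `f` is even** — `1 + 4ρ ∈ K_v²` iff `X² − X − ρ` has
a root mod `v` (tree `isSquare_one_add_four_mul_adicCompletion_iff`, O'Meara §63A), and in characteristic `2`,
`X² − X − 1 = X² + X + 1`. [cite: Omeara1963, §63A (quadratic defect of `1 + 4ρ`)] -/
theorem isSquare_five_adicCompletion_iff_even (h2 : (2 : 𝓞 K) ∈ v.asIdeal) {f : ℕ}
    (hf : Ideal.absNorm v.asIdeal = 2 ^ f) : IsSquare (5 : v.adicCompletion K) ↔ Even f := by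
  have h5 : (5 : v.adicCompletion K) = algebraMap (𝓞 K) (v.adicCompletion K) (1 + 4 * 1) := by
    rw [mul_one, map_add, map_one, map_ofNat]
    norm_num
  rw [h5, isSquare_one_add_four_mul_adicCompletion_iff K v h2 1]
  letI := Ideal.Quotient.field v.asIdeal
  letI : Fintype (𝓞 K ⧸ v.asIdeal) := Fintype.ofFinite _
  have h2k : (2 : 𝓞 K ⧸ v.asIdeal) = 0 := by
    rw [show (2 : 𝓞 K ⧸ v.asIdeal) = Ideal.Quotient.mk v.asIdeal 2 from (map_ofNat _ 2).symm,
      Ideal.Quotient.eq_zero_iff_mem]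
    exact h2
  haveI : CharP (𝓞 K ⧸ v.asIdeal) 2 :=
    (CharP.charP_iff_prime_eq_zero Nat.prime_two).mpr (by exact_mod_cast h2k)
  have hcard : Fintype.card (𝓞 K ⧸ v.asIdeal) = 2 ^ f := by
    rw [← Nat.card_eq_fintype_card, ← hf, Ideal.absNorm_apply, Submodule.cardQuot_apply]
  rw [← FiniteField.exists_sq_add_self_add_one_eq_zero_iff_even hcard]
  constructor
  · rintro ⟨r, hr⟩
    refine ⟨Ideal.Quotient.mk v.asIdeal r, ?_⟩
    have h := Ideal.Quotient.eq_zero_iff_mem.mpr hr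
    rw [map_sub, map_sub, map_pow, map_one] at h
    linear_combination h + (Ideal.Quotient.mk v.asIdeal r + 1) * h2k
  · rintro ⟨x, hx⟩
    obtain ⟨r, rfl⟩ := Ideal.Quotient.mk_surjective x
    refine ⟨r, Ideal.Quotient.eq_zero_iff_mem.mp ?_⟩
    rw [map_sub, map_sub, map_pow, map_one]
    linear_combination hx - (Ideal.Quotient.mk v.asIdeal r + 1) * h2k

/-- **`(t, 5)_v = −1` iff `f` and `ord_v t` are both odd** (`v ∣ 2`, `N v = 2^f`, `t ≠ 0`): the symbol of the unramified
extension `K_v(√5)/K_v`, inert iff `f` odd (O'Meara Example 63:16, tree `hilbertSymbol_one_add_four_mul_eq_neg_one_iff`).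
[cite: Omeara1963, §63C Example 63:16] -/
theorem hilbertSymbol_five_eq_neg_one_iff (h2 : (2 : 𝓞 K) ∈ v.asIdeal) {f : ℕ}
    (hf : Ideal.absNorm v.asIdeal = 2 ^ f) {t : v.adicCompletion K} (ht : t ≠ 0) :
    hilbertSymbol (v.adicCompletion K) t 5 = -1 ↔ Odd f ∧ Odd (WithZero.log (Valued.v t)) := by
  have h5 : (5 : v.adicCompletion K) = algebraMap (𝓞 K) (v.adicCompletion K) (1 + 4 * 1) := by
    rw [mul_one, map_add, map_one, map_ofNat]
    norm_num
  have h5v : (1 + 4 * 1 : 𝓞 K) ∉ v.asIdeal := fun h ↦ by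
    apply v.isPrime.ne_top
    rw [Ideal.eq_top_iff_one]
    have h1 : (1 : 𝓞 K) = (1 + 4 * 1) - 2 * 2 := by norm_num
    rw [h1]
    exact v.asIdeal.sub_mem h (v.asIdeal.mul_mem_left 2 h2)
  rw [h5, hilbertSymbol_one_add_four_mul_eq_neg_one_iff K v 1 h5v ht, ← h5,
    isSquare_five_adicCompletion_iff_even v h2 hf, Nat.not_even_iff_odd]

end Local


end Literature.NumberTheory.QuadraticForms

end
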